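import Literature.AlgebraicGeometry.HodgeTheory.HypersurfaceSectionLefschetz
import Literature.AlgebraicGeometry.HodgeTheory.HodgeTypeOfFlatSections
import Literature.AlgebraicGeometry.HodgeTheory.HardLefschetzNFoldHolds
import Literature.AlgebraicGeometry.HodgeTheory.HodgeConjectureQbarVoisinProofs
import Literature.AlgebraicGeometry.HodgeTheory.HodgeConjecture
import Literature.AlgebraicGeometry.HodgeTheory.ComplexConjugationHolds
import Literature.AlgebraicGeometry.HodgeTheory.AlgebraicClassesPullback
import Literature.AlgebraicGeometry.HodgeTheory.HolomorphicBundleChernCharacterProjectiveSpace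
import Literature.AlgebraicGeometry.HodgeTheory.HyperplaneSectionMonodromy
import HarnessLib

/-!
# The Hodge conjecture for hypersurface sections of an arbitrary smooth projective variety
# (Lefschetz-type closure of the known cases; general-ambient Noether–Lefschetz consequence form)

Vendored from the cell `hodge-nonav` planner sketch ROUTE-P1O (chapter LEF, §A–§G), which is proved
from tree theorems. The only non-definitional input is Fulton's Cor. 19.2 (b)
`fulton1998_map_mem_algebraicClasses` (pull-back of algebraic classes along a morphism of smooth
projective varieties, `HodgeTheory/AlgebraicClassesPullback`), carried here as the HYPOTHESIS `hFul`
so that this file is `Literature/`-admissible and fact-free; the summit side discharges it.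

* §A `exists_rational_hodge_preimage` — rational `(p,p)` classes in the range of an INJECTIVE
  pull-back `g^*` (`g : Y ⟶ X` smooth projective) are `g^* c₀` with `c₀` rational of type `(p,p)`
  (rational descent of ranges + type reflection: pull-backs are morphisms of Hodge structures,
  Voisin I §7.3.1–7.3.2).
* §B `mem_algebraicClasses_of_mem_range`, `…_of_bijective` — hence such classes are algebraic when
  the rational `(p,p)` classes of `X` are.
* §C abstract cores over a "Lefschetz package" for `g : Y ⟶ X` (`dim Y = m`):
  `hodgeConjectureFor_of_lefschetzPackage_odd` (`m` odd, `g^*` bijective on `H²ᵖ` for `2p < m`,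
  HCᵖ(X) there ⇒ HC(Y)); `hodgeConjectureFor_of_lefschetzPackage_even` (`m = 2k`, bijective below
  `2k`, injective on `H²ᵏ`, (VG) every rational `(k,k)` class of `Y` in the range of `g^*`, HCᵖ(X)
  for `p ≤ k` ⇒ HC(Y)). Above the middle: the tree's hard-Lefschetz reduction
  `HardLefschetzNFold.mem_algebraicClasses_of_lt_holds`.
* §D `hodgeConjectureFor_hypersurfaceSection_of_odd` (+ `_of_hodgeConjectureFor`, `_twoStep`, base
  `hc_projectiveSpace`): smooth ODD-dimensional hypersurface sections `Y = X ∩ V₊(F)` (any degree,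
  any embedding) of a smooth projective `X`: HC(X) ⇒ HC(Y) (package from
  `bijective_complexBettiMap_hypersurfaceSection_of_lt`, Voisin II Thm. 1.23; cf. Voisin, *Hodge
  loci* §4.3: the Lefschetz restriction maps are morphisms of Hodge structures, isomorphisms below
  the middle).
* §E `hodgeConjectureFor_hypersurfaceSection_of_middle_mem_range`: EVEN-dimensional sections under
  (VG) — the conclusion `Hdg²ᵏ(X_t) = j_t^* Hdg²ᵏ(X)` of Voisin, *Hodge loci*, Thm. 4.17 / Rem. 4.18
  for the very general member of a sufficiently ample linear system on ANY smooth projective `X` of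
  dimension `2k + 1`, taken as a hypothesis.
* §F–§G the "very general" quantifier `VeryGeneralSectionHodgeClassesFromAmbient k N X ι` — (VG) for
  `∀ᶠ H in residual (ℙᴺ)^*(ℂ)` over the tree's universal hyperplane section of `ι : X ⟶ ℙᴺ` —, the
  support predicate `UniversalSectionLefschetzPackage k N X ι`, and
  `veryGeneralSection_hodgeConjectureFor`: both + HC(X) ⇒ `∀ᶠ H, X ∩ H smooth → HC(X ∩ H)`.

No new named facts: the two `def`s of §F are predicates (hypothesis shapes), not asserted.

## References
[VoisinHodgeII2003] §1.2.2 Thm. 1.23, §2.3.3 Prop. 2.27; [VoisinHodgeI2002] Thm. 6.25, Rem. 6.27,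
§7.1.2, §7.3.1–7.3.2, Prop. 11.20; [Voisin2013HodgeLociSurvey] §4.3 Thm. 4.16–4.17, Rem. 4.18;
[Fulton1998] Cor. 19.2 (b) (as hypothesis `hFul`); [KerrPearlstein2011] §3.1; [Hartshorne1977]
I Ex. 1.8, II Ex. 5.10.
-/

noncomputable section

open CategoryTheory AlgebraicGeometry Filter
open Literature.AlgebraicGeometry.Motives
open Literature.AlgebraicGeometry.HodgeTheory
open Literature.AlgebraicTopology.SingularHomology

namespace Literature.AlgebraicGeometry.HodgeTheory.HypersurfaceSectionHC

/-! ### §A Rational Hodge classes descend along an injective pull-back -/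

/-- **Rational `(p,p)` classes in the range of an injective pull-back come from rational `(p,p)`
classes**: for a `ℂ`-morphism `g : Y ⟶ X` of smooth projective varieties with `g^*` injective on
`H²ᵖ`, a rational class `c` of type `(p,p)` on `Y` lying in the range of `g^*` is `g^* c₀` for a
rational class `c₀` of type `(p,p)` on `X`. [cite: VoisinHodgeI2002, §7.3.1–7.3.2] [cite: Voisin2013HodgeLociSurvey, §4.3 (pp. 18–19)] -/
theorem exists_rational_hodge_preimage {m n p : ℕ} {X Y : SchemeOver ℂ}
    (hX : IsSmoothProjective n X) (hY : IsSmoothProjective m Y) (g : Y ⟶ X)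
    (hinj : Function.Injective (complexBetti.map g (2 * p)))
    {c : complexBetti Y (2 * p)} (hc : IsRationalClass c) (hpp : IsOfHodgeType m Y (2 * p) p p c)
    (hrange : c ∈ LinearMap.range (complexBetti.map g (2 * p)).hom) :
    ∃ c₀ : complexBetti X (2 * p), IsRationalClass c₀ ∧ IsOfHodgeType n X (2 * p) p p c₀ ∧
      complexBetti.map g (2 * p) c₀ = c := by
  obtain ⟨c₁, hc₁⟩ := hrange
  have hc₁' : complexBetti.map g (2 * p) c₁ = c := hc₁
  obtain ⟨c₀, hc₀Q, hc₀⟩ :=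
    exists_isRationalClass_complexBetti_map_eq hX g c₁ (by rw [hc₁']; exact hc)
  rw [hc₁'] at hc₀
  refine ⟨c₀, hc₀Q, ?_, hc₀⟩
  obtain ⟨MX⟩ := nonempty_hodgeModel_holds hX
  obtain ⟨MY⟩ := nonempty_hodgeModel_holds hY
  have hpq : (p, p) ∈ Finset.HasAntidiagonal.antidiagonal (2 * p) :=
    Finset.HasAntidiagonal.mem_antidiagonal.2 (two_mul p).symm
  have hcY : c ∈ MY.typePiece (2 * p) ⟨(p, p), hpq⟩ :=
    (MY.mem_typePiece_iff ⟨(p, p), hpq⟩ _).2 (hpp.mem_hodgePQ hY MY)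
  have h1 : complexBetti.map g (2 * p) (MX.typeProj (2 * p) ⟨(p, p), hpq⟩ c₀) =
      complexBetti.map g (2 * p) c₀ := by
    rw [MX.map_typeProj_eq hY hX g MY ⟨(p, p), hpq⟩ c₀, hc₀]
    exact MY.typeProj_apply_of_mem hcY
  have h2 : MX.typeProj (2 * p) ⟨(p, p), hpq⟩ c₀ = c₀ := hinj h1
  have key := MX.isOfHodgeType_of_mem_typePiece (MX.typeProj_mem (2 * p) ⟨(p, p), hpq⟩ c₀)
  simp only at key
  rw [h2] at key
  exact key

/-! ### §B … hence are algebraic when the Hodge conjecture holds upstairs -/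

/-- **Algebraicity descends along an injective pull-back** (modulo Fulton Cor. 19.2 (b), `hFul`):
with `g`, `c` as in §A, if every rational `(p,p)` class on `X` is algebraic then `c` is algebraic. [cite: VoisinHodgeI2002, §7.3.1–7.3.2] [cite: Voisin2013HodgeLociSurvey, §4.3 (pp. 18–19)] -/
theorem mem_algebraicClasses_of_mem_range (hFul : fulton1998_map_mem_algebraicClasses)
    {m n p : ℕ} {X Y : SchemeOver ℂ}
    (hX : IsSmoothProjective n X) (hY : IsSmoothProjective m Y) (g : Y ⟶ X)
    (hinj : Function.Injective (complexBetti.map g (2 * p)))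
    {c : complexBetti Y (2 * p)} (hc : IsRationalClass c) (hpp : IsOfHodgeType m Y (2 * p) p p c)
    (hrange : c ∈ LinearMap.range (complexBetti.map g (2 * p)).hom)
    (hHC : ∀ c₀ : complexBetti X (2 * p), IsRationalClass c₀ →
      IsOfHodgeType n X (2 * p) p p c₀ → c₀ ∈ algebraicClasses X p) :
    c ∈ algebraicClasses Y p := by
  obtain ⟨c₀, h₀Q, h₀T, rfl⟩ := exists_rational_hodge_preimage hX hY g hinj hc hpp hrange
  exact hFul g hX hY p _ (hHC c₀ h₀Q h₀T)

/-- **Bijective pull-back**: HCᵖ(X) ⇒ HCᵖ(Y) when `g^* : H²ᵖ(X) → H²ᵖ(Y)` is bijective. [cite: VoisinHodgeI2002, §7.3.1–7.3.2] [cite: Voisin2013HodgeLociSurvey, §4.3 (pp. 18–19)] -/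
theorem mem_algebraicClasses_of_bijective (hFul : fulton1998_map_mem_algebraicClasses)
    {m n p : ℕ} {X Y : SchemeOver ℂ}
    (hX : IsSmoothProjective n X) (hY : IsSmoothProjective m Y) (g : Y ⟶ X)
    (hbij : Function.Bijective (complexBetti.map g (2 * p)))
    (hHC : ∀ c₀ : complexBetti X (2 * p), IsRationalClass c₀ →
      IsOfHodgeType n X (2 * p) p p c₀ → c₀ ∈ algebraicClasses X p)
    (c : complexBetti Y (2 * p)) (hc : IsRationalClass c) (hpp : IsOfHodgeType m Y (2 * p) p p c) :
    c ∈ algebraicClasses Y p := by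
  obtain ⟨c₁, hc₁⟩ := hbij.2 c
  exact mem_algebraicClasses_of_mem_range hFul hX hY g hbij.1 hc hpp ⟨c₁, hc₁⟩ hHC

/-! ### §C Abstract cores over a Lefschetz package -/

/-- **Odd core.** `g : Y ⟶ X` smooth projective, `dim Y = m` ODD, `g^*` bijective on `H²ᵖ` for
every `2p < m` (weak Lefschetz package); if the rational `(p,p)` classes of `X` are algebraic for
`2p < m`, the Hodge conjecture holds for `Y` (above the middle: hard Lefschetz on `Y`). [cite: Voisin2013HodgeLociSurvey, §4.3 (pp. 18–19)] [cite: VoisinHodgeI2002, Thm. 6.25, Rem. 6.27 and §7.1.2] -/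
theorem hodgeConjectureFor_of_lefschetzPackage_odd (hFul : fulton1998_map_mem_algebraicClasses)
    {m n : ℕ} {X Y : SchemeOver ℂ} (hX : IsSmoothProjective n X) (hY : IsSmoothProjective m Y)
    (g : Y ⟶ X) (hm : Odd m)
    (hbij : ∀ p : ℕ, 2 * p < m → Function.Bijective (complexBetti.map g (2 * p)))
    (hHC : ∀ p : ℕ, 2 * p < m → ∀ c₀ : complexBetti X (2 * p), IsRationalClass c₀ →
      IsOfHodgeType n X (2 * p) p p c₀ → c₀ ∈ algebraicClasses X p) :
    HodgeConjectureFor m Y := by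
  refine ⟨nonempty_hodgeModel_holds hY, fun p c hc hpp ↦ ?_⟩
  have hm1 : 0 < m := hm.pos
  have hne : 2 * p ≠ m := fun h ↦ (Nat.not_even_iff_odd.mpr hm) ⟨p, by omega⟩
  rcases Nat.lt_or_gt_of_ne hne with hlt | hgt
  · exact mem_algebraicClasses_of_bijective hFul hX hY g (hbij p hlt) (hHC p hlt) c hc hpp
  · exact HardLefschetzNFold.mem_algebraicClasses_of_lt_holds hY hgt
      (fun c' hc' hpp' ↦ mem_algebraicClasses_of_bijective hFul hX hY g
        (hbij (m - p) (by omega)) (hHC (m - p) (by omega)) c' hc' hpp') c hc hpp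

/-- **Even core.** `g : Y ⟶ X` smooth projective, `dim Y = 2k`, `g^*` bijective on `H²ᵖ` for
`2p < 2k` and injective on `H²ᵏ`; (VG) every rational `(k,k)` class of `Y` lies in the range of
`g^*`; the rational `(p,p)` classes of `X` are algebraic for `p ≤ k`. Then the Hodge conjecture holds
for `Y`. [cite: Voisin2013HodgeLociSurvey, §4.3 Thm. 4.17 with conditions (a), (b) and Rem. 4.18 (p. 19)] [cite: VoisinHodgeI2002, Thm. 6.25, Rem. 6.27 and §7.1.2] -/
theorem hodgeConjectureFor_of_lefschetzPackage_even (hFul : fulton1998_map_mem_algebraicClasses)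
    {k n : ℕ} {X Y : SchemeOver ℂ} (hX : IsSmoothProjective n X) (hY : IsSmoothProjective (2 * k) Y)
    (g : Y ⟶ X)
    (hbij : ∀ p : ℕ, 2 * p < 2 * k → Function.Bijective (complexBetti.map g (2 * p)))
    (hinj : Function.Injective (complexBetti.map g (2 * k)))
    (hVG : ∀ c : complexBetti Y (2 * k), IsRationalClass c → IsOfHodgeType (2 * k) Y (2 * k) k k c →
      c ∈ LinearMap.range (complexBetti.map g (2 * k)).hom)
    (hHC : ∀ p : ℕ, p ≤ k → ∀ c₀ : complexBetti X (2 * p), IsRationalClass c₀ →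
      IsOfHodgeType n X (2 * p) p p c₀ → c₀ ∈ algebraicClasses X p) :
    HodgeConjectureFor (2 * k) Y := by
  refine ⟨nonempty_hodgeModel_holds hY, fun p c hc hpp ↦ ?_⟩
  rcases Nat.lt_trichotomy p k with hlt | rfl | hgt
  · exact mem_algebraicClasses_of_bijective hFul hX hY g (hbij p (by omega)) (hHC p hlt.le) c hc hpp
  · exact mem_algebraicClasses_of_mem_range hFul hX hY g hinj hc hpp (hVG c hc hpp) (hHC p le_rfl)
  · refine HardLefschetzNFold.mem_algebraicClasses_of_lt_holds hY (by omega)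
      (fun c' hc' hpp' ↦ ?_) c hc hpp
    -- complementary degree `2(2k - p) < 2k`, or `0` when `p > 2k` (then every class is algebraic)
    generalize hq : 2 * k - p = q at c' hpp' ⊢
    rcases Nat.eq_zero_or_pos q with rfl | hqpos
    · rw [algebraicClasses_zero]; exact Submodule.mem_top
    · exact mem_algebraicClasses_of_bijective hFul hX hY g (hbij q (by omega)) (hHC q (by omega))
        c' hc' hpp'

/-! ### §D Row CL-LEF1: odd-dimensional hypersurface sections of a smooth projective variety -/

/-- **ROW CL-LEF1.** `X` smooth projective of EVEN dimension `m + 1`, `e` any projective embedding,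
`F` a form of degree `d ≥ 1` with smooth section `Y = X ∩ V₊(F)` of (odd) dimension `m`: if the
rational `(p,p)` classes of `X` are algebraic for every `2p < m`, the Hodge conjecture holds for `Y`. [cite: VoisinHodgeII2003, §1.2.2 Thm. 1.23] [cite: Voisin2013HodgeLociSurvey, §4.3 (pp. 18–19)] [cite: VoisinHodgeI2002, Thm. 6.25, Rem. 6.27 and §7.1.2] -/
theorem hodgeConjectureFor_hypersurfaceSection_of_odd (hFul : fulton1998_map_mem_algebraicClasses)
    {m : ℕ} {X : SchemeOver ℂ} (hX : IsSmoothProjective (m + 1) X) (e : ProjectiveEmbedding X)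
    {d : ℕ} (hd : 1 ≤ d) (F : MvPolynomial (Fin (e.n + 1)) ℂ) (hF : F.IsHomogeneous d)
    (hY : IsSmoothProjective m (e.hypersurfaceSection F hF)) (hm : Odd m)
    (hHC : ∀ p : ℕ, 2 * p < m → ∀ c₀ : complexBetti X (2 * p), IsRationalClass c₀ →
      IsOfHodgeType (m + 1) X (2 * p) p p c₀ → c₀ ∈ algebraicClasses X p) :
    HodgeConjectureFor m (e.hypersurfaceSection F hF) :=
  hodgeConjectureFor_of_lefschetzPackage_odd hFul hX hY (e.hypersurfaceSectionι F hF) hm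
    (fun _ hp ↦ bijective_complexBettiMap_hypersurfaceSection_of_lt hX e hd F hF hY hp) hHC

/-- **CL-LEF1, closure form: HC(X) ⇒ HC(X ∩ V₊(F))** for every smooth odd-dimensional hypersurface
section of a smooth projective `X`, any degree, any embedding. [cite: VoisinHodgeII2003, §1.2.2 Thm. 1.23] [cite: Voisin2013HodgeLociSurvey, §4.3 (pp. 18–19)] -/
theorem hodgeConjectureFor_hypersurfaceSection_of_odd_of_hodgeConjectureFor
    (hFul : fulton1998_map_mem_algebraicClasses)
    {m : ℕ} {X : SchemeOver ℂ} (hX : IsSmoothProjective (m + 1) X) (e : ProjectiveEmbedding X)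
    {d : ℕ} (hd : 1 ≤ d) (F : MvPolynomial (Fin (e.n + 1)) ℂ) (hF : F.IsHomogeneous d)
    (hY : IsSmoothProjective m (e.hypersurfaceSection F hF)) (hm : Odd m)
    (hHC : HodgeConjectureFor (m + 1) X) :
    HodgeConjectureFor m (e.hypersurfaceSection F hF) :=
  hodgeConjectureFor_hypersurfaceSection_of_odd hFul hX e hd F hF hY hm
    (fun p _ c₀ h₁ h₂ ↦ hHC.2 p c₀ h₁ h₂)

/-- **CL-LEF1 along a two-step smooth flag**: `X` smooth projective of dimension `m + 2`,
`Y₁ = X ∩ V₊(F)` smooth of dimension `m + 1`, `Y = Y₁ ∩ V₊(G)` smooth of ODD dimension `m` (in any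
embedding `e₁` of `Y₁`); HCᵖ(X) for `2p < m` ⇒ HC(Y). (Iterates along any smooth flag of
hypersurface sections ending in odd dimension: each descent below the middle is §B.) [cite: VoisinHodgeII2003, §1.2.2 Thm. 1.23] [cite: Voisin2013HodgeLociSurvey, §4.3 (pp. 18–19)] -/
theorem hodgeConjectureFor_hypersurfaceSection_twoStep (hFul : fulton1998_map_mem_algebraicClasses)
    {m : ℕ} {X : SchemeOver ℂ} (hX : IsSmoothProjective (m + 2) X) (e : ProjectiveEmbedding X)
    {d : ℕ} (hd : 1 ≤ d) (F : MvPolynomial (Fin (e.n + 1)) ℂ) (hF : F.IsHomogeneous d)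
    (hY₁ : IsSmoothProjective (m + 1) (e.hypersurfaceSection F hF))
    (e₁ : ProjectiveEmbedding (e.hypersurfaceSection F hF)) {d₁ : ℕ} (hd₁ : 1 ≤ d₁)
    (G : MvPolynomial (Fin (e₁.n + 1)) ℂ) (hG : G.IsHomogeneous d₁)
    (hY : IsSmoothProjective m (e₁.hypersurfaceSection G hG)) (hm : Odd m)
    (hHC : ∀ p : ℕ, 2 * p < m → ∀ c₀ : complexBetti X (2 * p), IsRationalClass c₀ →
      IsOfHodgeType (m + 2) X (2 * p) p p c₀ → c₀ ∈ algebraicClasses X p) :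
    HodgeConjectureFor m (e₁.hypersurfaceSection G hG) :=
  hodgeConjectureFor_hypersurfaceSection_of_odd hFul hY₁ e₁ hd₁ G hG hY hm
    (fun p hp c₁ h₁ h₂ ↦ mem_algebraicClasses_of_bijective hFul hX hY₁ (e.hypersurfaceSectionι F hF)
      (bijective_complexBettiMap_hypersurfaceSection_of_lt hX e hd F hF hY₁ (k := 2 * p) (by omega))
      (hHC p hp) c₁ h₁ h₂)

/-- **Base of the flag ladder: every class on `ℙᴺ_ℂ` is algebraic** (tree theorem
`algebraicClasses_projectiveSpace_eq_top`), in the hypothesis shape of CL-LEF1. [cite: VoisinHodgeI2002, Prop. 11.20] [cite: Hartshorne1977, I Ex. 1.8 and II Ex. 5.10] -/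
theorem hc_projectiveSpace (N p : ℕ) (c₀ : complexBetti (projectiveSpace N ℂ) (2 * p)) :
    c₀ ∈ algebraicClasses (projectiveSpace N ℂ) p := by
  rw [algebraicClasses_projectiveSpace_eq_top N p]; trivial

/-! ### §E Row CL-LEF2 (consequence form of Voisin, Hodge loci Thm. 4.17, general ambient) -/

/-- **ROW CL-LEF2, consequence form.** `X` smooth projective of ODD dimension `2k + 1`,
`Y = X ∩ V₊(F)` a smooth section of dimension `2k` (any degree, any embedding) such that
(VG) every rational `(k,k)` class of `Y` lies in the range of `H²ᵏ(X) → H²ᵏ(Y)`; if the rational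
`(p,p)` classes of `X` are algebraic for `p ≤ k`, the Hodge conjecture holds for `Y` (restriction is
bijective below `2k` and injective on `H²ᵏ`, Voisin II Thm. 1.23). [cite: Voisin2013HodgeLociSurvey, §4.3 Thm. 4.17 with conditions (a), (b) and Rem. 4.18 (p. 19)] [cite: VoisinHodgeII2003, §1.2.2 Thm. 1.23] -/
theorem hodgeConjectureFor_hypersurfaceSection_of_middle_mem_range
    (hFul : fulton1998_map_mem_algebraicClasses)
    {k : ℕ} {X : SchemeOver ℂ} (hX : IsSmoothProjective (2 * k + 1) X) (e : ProjectiveEmbedding X)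
    {d : ℕ} (hd : 1 ≤ d) (F : MvPolynomial (Fin (e.n + 1)) ℂ) (hF : F.IsHomogeneous d)
    (hY : IsSmoothProjective (2 * k) (e.hypersurfaceSection F hF))
    (hVG : ∀ c : complexBetti (e.hypersurfaceSection F hF) (2 * k), IsRationalClass c →
      IsOfHodgeType (2 * k) (e.hypersurfaceSection F hF) (2 * k) k k c →
      c ∈ LinearMap.range (complexBetti.map (e.hypersurfaceSectionι F hF) (2 * k)).hom)
    (hHC : ∀ p : ℕ, p ≤ k → ∀ c₀ : complexBetti X (2 * p), IsRationalClass c₀ →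
      IsOfHodgeType (2 * k + 1) X (2 * p) p p c₀ → c₀ ∈ algebraicClasses X p) :
    HodgeConjectureFor (2 * k) (e.hypersurfaceSection F hF) :=
  hodgeConjectureFor_of_lefschetzPackage_even hFul hX hY (e.hypersurfaceSectionι F hF)
    (fun _ hp ↦ bijective_complexBettiMap_hypersurfaceSection_of_lt hX e hd F hF hY hp)
    (injective_complexBettiMap_hypersurfaceSection hX e hd F hF hY le_rfl) hVG hHC

/-- **CL-LEF2, closure form: (VG) ∧ HC(X) ⇒ HC(X ∩ V₊(F))**. [cite: Voisin2013HodgeLociSurvey, §4.3 Thm. 4.17 with conditions (a), (b) and Rem. 4.18 (p. 19)] [cite: VoisinHodgeII2003, §1.2.2 Thm. 1.23] -/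
theorem hodgeConjectureFor_hypersurfaceSection_of_middle_mem_range_of_hodgeConjectureFor
    (hFul : fulton1998_map_mem_algebraicClasses)
    {k : ℕ} {X : SchemeOver ℂ} (hX : IsSmoothProjective (2 * k + 1) X) (e : ProjectiveEmbedding X)
    {d : ℕ} (hd : 1 ≤ d) (F : MvPolynomial (Fin (e.n + 1)) ℂ) (hF : F.IsHomogeneous d)
    (hY : IsSmoothProjective (2 * k) (e.hypersurfaceSection F hF))
    (hVG : ∀ c : complexBetti (e.hypersurfaceSection F hF) (2 * k), IsRationalClass c →
      IsOfHodgeType (2 * k) (e.hypersurfaceSection F hF) (2 * k) k k c →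
      c ∈ LinearMap.range (complexBetti.map (e.hypersurfaceSectionι F hF) (2 * k)).hom)
    (hHC : HodgeConjectureFor (2 * k + 1) X) :
    HodgeConjectureFor (2 * k) (e.hypersurfaceSection F hF) :=
  hodgeConjectureFor_hypersurfaceSection_of_middle_mem_range hFul hX e hd F hF hY hVG
    (fun p _ c₀ h₁ h₂ ↦ hHC.2 p c₀ h₁ h₂)

/-! ### §F The "very general member" quantifier over the universal hyperplane section of `X ⊂ ℙᴺ` -/

/-- **(VG) for the very general hyperplane section** of `ι : X ⟶ ℙᴺ_ℂ` with `2k`-dimensional smooth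
members: for all `H` in a residual subset of `(ℙᴺ)^*(ℂ)`, if `X ∩ H` (the fibre of the tree's
universal hyperplane section `pr₂ : 𝒳 ⟶ (ℙᴺ)^*` over `H`) is smooth projective of dimension `2k`,
every rational `(k,k)` class of `X ∩ H` is the restriction of a class of `X`. This is the CONCLUSION
of Voisin, Hodge loci, Thm. 4.17 + Rem. 4.18 (`Hdg²ᵏ(X_t)_van = 0` for very general `t`, any smooth
projective `X` of dimension `2k + 1`, `ι` the embedding by a SUFFICIENTLY AMPLE `H`: (a) very ample
with a member having ordinary double points, (b) `h^{k-1,k+1}_van ≠ 0`), read through the Lefschetz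
decomposition `H²ᵏ(X_t, ℚ) = H²ᵏ_van ⊕ j_t^* H²ᵏ(X, ℚ)` (Voisin II Prop. 2.27). Degree-`d`
hypersurface sections = hyperplane sections of the `d`-uple re-embedding. [cite: Voisin2013HodgeLociSurvey, §4.3 Thm. 4.17 with conditions (a), (b) and Rem. 4.18 (p. 19)] [cite: VoisinHodgeII2003, §2.3.3 Prop. 2.27] -/
def VeryGeneralSectionHodgeClassesFromAmbient (k N : ℕ) (X : SchemeOver ℂ)
    (ι : X ⟶ projectiveSpace N ℂ) : Prop :=
  ∀ᶠ H in residual (ComplexPoints (dualProjectiveSpace N ℂ)),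
    H ∈ universalSmoothLocus N ι (2 * k) →
      ∀ c : complexBetti (fiberOver (UniversalHyperplaneSection.proj N ι) H) (2 * k),
        IsRationalClass c →
        IsOfHodgeType (2 * k) (fiberOver (UniversalHyperplaneSection.proj N ι) H) (2 * k) k k c →
        c ∈ LinearMap.range (complexBetti.map
          (fiberι (UniversalHyperplaneSection.proj N ι) H ≫ UniversalHyperplaneSection.toX N ι)
          (2 * k)).hom

/-- **The weak Lefschetz package for the smooth members of the universal hyperplane section** of
`ι : X ⟶ ℙᴺ` (`dim X = 2k + 1`): for `H` with `X ∩ H` smooth of dimension `2k`, restriction along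
`X ∩ H ⟶ 𝒳 ⟶ X` is bijective on `Hʲ` for `j < 2k` and injective on `H²ᵏ`. PROVABLE NOW by the
argument of `LinearSectionPencilFibres.bijective_complexBettiMap_fiberι_blowDown_of_lt` (Andreotti–
Frankel for the complement of the member + the two duality steps), once the range of
`(X ∩ H)(ℂ) → X(ℂ)` is identified with the hyperplane section on points (the universal-family twin of
`range_map_fiberι_blowDown`); recorded as a support statement (memo §3 S-LEF1). [cite: VoisinHodgeII2003, §1.2.2 Thm. 1.23] [cite: Voisin2013HodgeLociSurvey, §4.3 (pp. 18–19)] -/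
def UniversalSectionLefschetzPackage (k N : ℕ) (X : SchemeOver ℂ)
    (ι : X ⟶ projectiveSpace N ℂ) : Prop :=
  ∀ H ∈ universalSmoothLocus N ι (2 * k),
    (∀ j : ℕ, j < 2 * k → Function.Bijective (complexBetti.map
      (fiberι (UniversalHyperplaneSection.proj N ι) H ≫ UniversalHyperplaneSection.toX N ι) j)) ∧
    Function.Injective (complexBetti.map
      (fiberι (UniversalHyperplaneSection.proj N ι) H ≫ UniversalHyperplaneSection.toX N ι) (2 * k))

/-- **ROW CL-LEF2 with the very-general quantifier**: for `X ⊂ ℙᴺ_ℂ` smooth projective of dimension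
`2k + 1` satisfying the Hodge conjecture, (VG) for the very general section and the Lefschetz package
of the members give: for all `H` in a residual subset of `(ℙᴺ)^*(ℂ)`, if `X ∩ H` is smooth of
dimension `2k` then `X ∩ H` satisfies the Hodge conjecture. [cite: Voisin2013HodgeLociSurvey, §4.3 Thm. 4.17 with conditions (a), (b) and Rem. 4.18 (p. 19)] [cite: Voisin2013HodgeLociSurvey, §4.3 (pp. 18–19)] -/
theorem veryGeneralSection_hodgeConjectureFor (hFul : fulton1998_map_mem_algebraicClasses)
    {k N : ℕ} {X : SchemeOver ℂ} (hX : IsSmoothProjective (2 * k + 1) X)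
    (ι : X ⟶ projectiveSpace N ℂ)
    (hVG : VeryGeneralSectionHodgeClassesFromAmbient k N X ι)
    (hLef : UniversalSectionLefschetzPackage k N X ι) (hHC : HodgeConjectureFor (2 * k + 1) X) :
    ∀ᶠ H in residual (ComplexPoints (dualProjectiveSpace N ℂ)),
      H ∈ universalSmoothLocus N ι (2 * k) →
        HodgeConjectureFor (2 * k) (fiberOver (UniversalHyperplaneSection.proj N ι) H) := by
  filter_upwards [hVG] with H hH hU
  have hY : IsSmoothProjective (2 * k) (fiberOver (UniversalHyperplaneSection.proj N ι) H) := hU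
  exact hodgeConjectureFor_of_lefschetzPackage_even hFul hX hY
    (fiberι (UniversalHyperplaneSection.proj N ι) H ≫ UniversalHyperplaneSection.toX N ι)
    (fun p hp ↦ (hLef H hU).1 (2 * p) hp) (hLef H hU).2 (hH hU) (fun p _ c₀ h₁ h₂ ↦ hHC.2 p c₀ h₁ h₂)

end Literature.AlgebraicGeometry.HodgeTheory.HypersurfaceSectionHC
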